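import Summits.Ventures.PercRepro.RankLevelSetMinorPairSkewSum
import Summits.Ventures.PercRepro.RankLevelSetBiIndepContainHalfPaving

/-! # RankLevelSetBiIndepContainCum — THE BRIDGE FROM THE REFLECTION FORMS (CX*) ∧ (CX) TO THE CUMULATIVE (CX*), GIVEN
UNIMODALITY; THE SUM THEOREMS FOR THE CELL'S PROPS (night-1 g30; dossier §42)

The cell's contain-set Props are REFLECTION statements: `BiContainSkew M` (`α^X_k ≤ α^X_{#E−1−k}`, g28) and
`BiContainMono M` (`α^X_k ≤ α^X_{k+1}` up to the middle). The sum theorems of `RankLevelSetMinorPairSkewSum` take the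
CUMULATIVE (CX*) `MinorPairSkew M X ∅ (#E − 2#X − 1)` (`α^X_i ≤ α^X_j` for `i < j`, `i + j ≤ #E − 1`). With
UNIMODALITY of the contain profiles (`BiContainUnimodal M`, a `Prop`: `min(α_i, α_k) ≤ α_j` for `i ≤ j ≤ k` — the
consequence of the named Lorentzian fact for the pair `(M/X, M∖X)`, NOT proved here) the two are equivalent:
**`minorPairSkew_contain_of_skew_mono_unimodal`**: (CX*) ∧ (CX) ∧ unimodal ⟹ cumulative (CX*) (for `i < j ≤ #E−1−i`
with `j` past the middle, `α_j ≥ min(α_{⌊#E/2⌋}, α_{#E−1−i}) ≥ α_i`). Hence the sum theorems in the cell's vocabulary: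
**`biContainSkew_disjointSum_of_skew_mono_unimodal_paving`** — `BiContainSkew M`, `BiContainMono M`,
`BiContainUnimodal M` and `Paving N` give `BiContainSkew (M ⊕ N)` with every split contain-set — and the version with
a half-rule summand. Every declaration has a docstring; imports: the cell's own modules and Mathlib only.
Axioms: standard. -/

namespace PercRepro

open Set Matroid

variable {α : Type} (M : Matroid α) [M.Finite]

omit [M.Finite] in
/-- **Unimodality of the contain profiles** (a `Prop`, NOT asserted; the consequence of the named Lorentzian fact for
the pair `(M/X, M∖X)`): `min(α^X_i, α^X_k) ≤ α^X_j` whenever `i ≤ j ≤ k`. -/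
def BiContainUnimodal : Prop :=
  ∀ X ⊆ M.E, ∀ i j k : ℕ, i ≤ j → j ≤ k → min (biContainCount M X i) (biContainCount M X k) ≤ biContainCount M X j

omit [M.Finite] in
/-- (CX) chains: `α^X_i ≤ α^X_j` for `i ≤ j ≤ ⌊#E/2⌋`. -/
lemma biContainCount_le_of_le_of_mono (h : BiContainMono M) {X : Set α} (hX : X ⊆ M.E) {i j : ℕ} (hij : i ≤ j)
    (hj : 2 * j ≤ M.E.ncard) : biContainCount M X i ≤ biContainCount M X j := by
  induction j with
  | zero =>
    have : i = 0 := by omega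
    rw [this]
  | succ j ih =>
    rcases Nat.eq_or_lt_of_le hij with rfl | hlt
    · exact le_rfl
    · exact (ih (by omega) (by omega)).trans (h X hX j (by omega))

/-- **THE BRIDGE**: (CX*) ∧ (CX) ∧ unimodality ⟹ the cumulative (CX*) on every contain-set. -/
theorem minorPairSkew_contain_of_skew_mono_unimodal (h1 : BiContainSkew M) (h2 : BiContainMono M)
    (h3 : BiContainUnimodal M) : ∀ X ⊆ M.E, MinorPairSkew M X ∅ (M.E.ncard - 2 * X.ncard - 1) := by
  intro X hX i j hij hR
  have hXE : X.ncard ≤ M.E.ncard := Set.ncard_le_ncard hX M.ground_finite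
  have hi := biContainCount_eq_minorPairCount M hX (k := i + X.ncard) (by omega)
  have hj := biContainCount_eq_minorPairCount M hX (k := j + X.ncard) (by omega)
  rw [Nat.add_sub_cancel] at hi hj
  rw [← hi, ← hj]
  -- levels `k = i + #X < k' = j + #X` with `k + k' ≤ #E − 1`
  set k := i + X.ncard with hk
  set k' := j + X.ncard with hk'
  have hkk' : k + k' + 1 ≤ M.E.ncard := by omega
  by_cases hmid : 2 * k' ≤ M.E.ncard
  · exact biContainCount_le_of_le_of_mono M h2 hX (by omega) hmid
  · -- `k'` is past the middle: `α_{k'} ≥ min(α_{⌊#E/2⌋}, α_{#E−1−k}) ≥ α_k`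
    have hm : k ≤ M.E.ncard / 2 := by omega
    have h4 : biContainCount M X k ≤ biContainCount M X (M.E.ncard / 2) :=
      biContainCount_le_of_le_of_mono M h2 hX hm (by omega)
    have h5 : biContainCount M X k ≤ biContainCount M X (M.E.ncard - 1 - k) := h1 X hX k (by omega)
    have h6 := h3 X hX (M.E.ncard / 2) k' (M.E.ncard - 1 - k) (by omega) (by omega)
    exact le_trans (le_min h4 h5) h6

/-- **(CX*) ON `M ⊕ N` IN THE CELL'S VOCABULARY, PAVING SUMMAND**: `BiContainSkew M`, `BiContainMono M`,
`BiContainUnimodal M`, `Paving N` ⟹ `BiContainSkew (M ⊕ N)` (every split contain-set). -/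
theorem biContainSkew_disjointSum_of_skew_mono_unimodal_paving {N : Matroid α} [N.Finite] {h : Disjoint M.E N.E}
    (h1 : BiContainSkew M) (h2 : BiContainMono M) (h3 : BiContainUnimodal M) (hN : Paving N) :
    haveI : (M.disjointSum N h).Finite := ⟨by
      rw [Matroid.disjointSum_ground_eq]; exact M.ground_finite.union N.ground_finite⟩
    BiContainSkew (M.disjointSum N h) :=
  biContainSkew_disjointSum_of_paving M (minorPairSkew_contain_of_skew_mono_unimodal M h1 h2 h3) hN

/-- **(CX*) ON `M ⊕ N` IN THE CELL'S VOCABULARY, HALF-RULE SUMMAND**: with `N` satisfying the half rule on every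
contain-set. -/
theorem biContainSkew_disjointSum_of_skew_mono_unimodal_half {N : Matroid α} [N.Finite] {h : Disjoint M.E N.E}
    (h1 : BiContainSkew M) (h2 : BiContainMono M) (h3 : BiContainUnimodal M)
    (hN : ∀ X ⊆ N.E, MinorPairSkew N X ∅ (N.E.ncard - 2 * X.ncard)) :
    haveI : (M.disjointSum N h).Finite := ⟨by
      rw [Matroid.disjointSum_ground_eq]; exact M.ground_finite.union N.ground_finite⟩
    BiContainSkew (M.disjointSum N h) :=
  biContainSkew_disjointSum_of_half (minorPairSkew_contain_of_skew_mono_unimodal M h1 h2 h3) hN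

end PercRepro
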